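import Literature.NumberTheory.LFunctions.DirichletLFunctionLogDerivBound
import Literature.NumberTheory.LFunctions.DirichletMVTSharp
import Mathlib.Analysis.Complex.Liouville
import Mathlib.Analysis.Calculus.MeanValue
import HarnessLib

/-!
# The mean value of `L′/L(1 + it, χ)`: `∫_{−T}^{T} |L′/L(1 + it, χ)| dt = O(T)` (support for Lagarias 2005, Thm 5.2)

LINE 1 — LABEL: RH-FREE (an unconditional mean-value bound for the logarithmic derivative of a Dirichlet
`L`-function ON the line `σ = 1`). bears_on: LADDER-RH B-C/B-P (COLUMN 6, de Branges; cell rh-crit/dbl row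
«dbl:R14-La05T5.2(1)», consumer: the discharge of `lagarias2005_thm_5_2_1` at the endpoint `|h| = ½`). WHAT THIS IS
NOT: no statement about zeros on or near the critical line; `σ = 1` analysis of `L(s, χ)` from the classical
zero-free region; nothing in this module bears on the truth of RH or GRH.

Proofs only (no definition, no named fact).

## Why, and what is proved

Lagarias (*Zero spacing distributions for differenced L-functions*, Acta Arith. 120 (2005), proof of Theorem 5.2,
arXiv p. 10) needs at `|h| = ½` "the analogue of part (2) [of Lemma 4.1]", a bound `L′/L(1 + iT, χ) = o(log T)`.
The tree has no sup-norm bound of that strength for `L(s, χ)` (no Vinogradov–Korobov/Richert input for Dirichlet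
`L`-functions; `DirichletLFunctionLogDerivBound.lean` gives `O(log t)`-class bounds from the classical zero-free
region). The averaged form suffices for the zero-spacing COUNT (sibling
`LagariasSpacingAveragedPhaseProofs.lean`), and it IS available:

* `DirichletLogDerivMeanValue.exists_integral_norm_logDeriv_one_le` — for `χ ≠ χ₀` mod `q` there is `C` with
  `∫_{−T}^{T} ‖L′/L(1 + it, χ)‖ dt ≤ C T` for all `T ≥ 1`.

Proof (Montgomery–Vaughan mean value theorem + the classical zero-free region): on `σ_T = 1 + η_T`,
`η_T = 1/(K log³(T+5))`, `−L′/L(σ_T + it, χ) = Σ χ(n)Λ(n)n^{−σ_T} n^{−it}` (MV (4.25)), and the tree's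
`ℓ¹`-form of the Montgomery–Vaughan mean value theorem (`DirichletMVT.meanSquare_tsum_shift_le`:
`∫_{−T}^{T} |Σ c_n n^{−it}|² ≤ Σ (5T + 20 + 65 n)|c_n|²`) with `Σ Λ(n)/n^σ ≤ 1/(σ−1) + K₀`
(`DirichletZFR.exists_norm_logDeriv_le`) and `log n ≤ n^η/η` gives `∫_{−T}^{T} |L′/L(σ_T + it)|² ≤ A T +
B log⁶(T+5)`; by `|x| ≤ ½ + ½|x|²` this is an `L¹` bound `O(T)`. The shift back to `σ = 1` for `1 ≤ |t| ≤ T`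
costs `|L′/L(1+it) − L′/L(σ_T+it)| ≤ η_T · sup |(L′/L)′| ≤ 1`, the sup taken over a disc of radius
`≍ 1/log(qT)` inside the region of `DirichletZFR.exists_norm_logDeriv_le_of_re_ge` (`L ≠ 0`,
`‖L′/L‖ ≪_q log(|t|+4)` there) via the Cauchy estimate (`Complex.norm_deriv_le_of_forall_mem_sphere_norm_le`)
and the mean value inequality (`Convex.norm_image_sub_le_of_norm_deriv_le`); `|t| ≤ 1` is a compact segment on
which `L′/L(1 + it, χ)` is continuous (`L(1 + it, χ) ≠ 0`, Mathlib).

## References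

* [Lagarias2005] J. C. Lagarias, Acta Arith. 120 (2005) 159–184 = arXiv:math/0601653, proof of Theorem 5.2
  (arXiv p. 10; held text `paper:arxiv-math_0601653` p0010:L143–175).
* [MontgomeryVaughan2007] H. L. Montgomery, R. C. Vaughan, *Multiplicative Number Theory I*, (4.25), §11.1
  (Theorems 11.3–11.4), and Montgomery–Vaughan 1974 Corollary 3 (mean value theorem) as proved in
  `DirichletMVTSharp.lean`.
-/

noncomputable section

open Complex Set MeasureTheory Filter Topology intervalIntegral Metric
open scoped Real ArithmeticFunction.vonMangoldt LSeries.notation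

namespace Literature.NumberTheory.LFunctions

namespace DirichletLogDerivMeanValue

/-! ## 1. Two bounds for `Σ Λ(n)² n^{−2σ}`, `σ = 1 + η` -/

/-- `Λ(n)²/n^{2+2η} ≤ 2 Λ(n)/n^{3/2}` (`Λ(n) ≤ log n ≤ 2√n`, `n^{2+2η} ≥ n²`). [folklore] -/
private theorem vonMangoldt_sq_div_le_one (n : ℕ) {η : ℝ} (hη : 0 < η) :
    Λ n ^ 2 / (n : ℝ) ^ (2 + 2 * η) ≤ 2 * (Λ n / (n : ℝ) ^ (3 / 2 : ℝ)) := by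
  rcases Nat.eq_zero_or_pos n with rfl | hn
  · simp
  have hn1 : (1 : ℝ) ≤ n := by exact_mod_cast hn
  have hn0 : (0 : ℝ) < n := by positivity
  have hΛ : 0 ≤ Λ n := ArithmeticFunction.vonMangoldt_nonneg
  have hlog : Λ n ≤ 2 * (n : ℝ) ^ (1 / 2 : ℝ) := by
    refine ArithmeticFunction.vonMangoldt_le_log.trans ?_
    have := Real.log_le_rpow_div hn0.le (by norm_num : (0:ℝ) < 1 / 2)
    linarith
  have h1 : Λ n ^ 2 ≤ 2 * (n : ℝ) ^ (1 / 2 : ℝ) * Λ n := by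
    rw [sq]; exact mul_le_mul_of_nonneg_right hlog hΛ
  have h2 : (n : ℝ) ^ (2 : ℝ) ≤ (n : ℝ) ^ (2 + 2 * η) :=
    Real.rpow_le_rpow_of_exponent_le hn1 (by linarith)
  have h3 : (n : ℝ) ^ (2 : ℝ) = (n : ℝ) ^ (1 / 2 : ℝ) * (n : ℝ) ^ (3 / 2 : ℝ) := by
    rw [← Real.rpow_add hn0]; norm_num
  have hpos2 : 0 < (n : ℝ) ^ (2 + 2 * η) := by positivity
  have hpos32 : 0 < (n : ℝ) ^ (3 / 2 : ℝ) := by positivity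
  have hpos12 : 0 < (n : ℝ) ^ (1 / 2 : ℝ) := by positivity
  calc Λ n ^ 2 / (n : ℝ) ^ (2 + 2 * η) ≤ Λ n ^ 2 / (n : ℝ) ^ (2 : ℝ) :=
        div_le_div_of_nonneg_left (by positivity) (by positivity) h2
    _ ≤ (2 * (n : ℝ) ^ (1 / 2 : ℝ) * Λ n) / (n : ℝ) ^ (2 : ℝ) :=
        div_le_div_of_nonneg_right h1 (by positivity)
    _ = 2 * (Λ n / (n : ℝ) ^ (3 / 2 : ℝ)) := by
        rw [h3]; field_simp

/-- `n · Λ(n)²/n^{2+2η} ≤ η⁻¹ Λ(n)/n^{1+η}` (`Λ(n) ≤ log n ≤ n^η/η`). [folklore] -/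
private theorem mul_vonMangoldt_sq_div_le (n : ℕ) {η : ℝ} (hη : 0 < η) :
    (n : ℝ) * (Λ n ^ 2 / (n : ℝ) ^ (2 + 2 * η)) ≤ 1 / η * (Λ n / (n : ℝ) ^ (1 + η)) := by
  rcases Nat.eq_zero_or_pos n with rfl | hn
  · simp
  have hn0 : (0 : ℝ) < n := by exact_mod_cast hn
  have hΛ : 0 ≤ Λ n := ArithmeticFunction.vonMangoldt_nonneg
  have hlog : Λ n ≤ (n : ℝ) ^ η / η :=
    ArithmeticFunction.vonMangoldt_le_log.trans (Real.log_le_rpow_div hn0.le hη)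
  have h1 : Λ n ^ 2 ≤ (n : ℝ) ^ η / η * Λ n := by
    rw [sq]; exact mul_le_mul_of_nonneg_right hlog hΛ
  have h3 : (n : ℝ) ^ (2 + 2 * η) = (n : ℝ) * ((n : ℝ) ^ η * (n : ℝ) ^ (1 + η)) := by
    rw [← Real.rpow_add hn0, show η + (1 + η) = 1 + 2 * η by ring,
      show (2 + 2 * η) = 1 + (1 + 2 * η) by ring, Real.rpow_add hn0, Real.rpow_one]
  have hposη : 0 < (n : ℝ) ^ η := by positivity
  have hpos1 : 0 < (n : ℝ) ^ (1 + η) := by positivity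
  rw [h3]
  calc (n : ℝ) * (Λ n ^ 2 / ((n : ℝ) * ((n : ℝ) ^ η * (n : ℝ) ^ (1 + η))))
      = Λ n ^ 2 / ((n : ℝ) ^ η * (n : ℝ) ^ (1 + η)) := by field_simp
    _ ≤ ((n : ℝ) ^ η / η * Λ n) / ((n : ℝ) ^ η * (n : ℝ) ^ (1 + η)) :=
        div_le_div_of_nonneg_right h1 (by positivity)
    _ = 1 / η * (Λ n / (n : ℝ) ^ (1 + η)) := by field_simp

/-- The two series bounds: with the absolute `K₀` of `DirichletZFR.exists_norm_logDeriv_le`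
(`Σ Λ(n)/n^σ ≤ 1/(σ−1) + K₀`, `1 < σ ≤ 2`), for `0 < η ≤ ½`:
`Σ Λ(n)²/n^{2+2η} ≤ 2(2 + K₀)` and `Σ n Λ(n)²/n^{2+2η} ≤ η⁻¹(η⁻¹ + K₀)`.
[cite: MontgomeryVaughan2007, p. 277 (proof of Theorem 11.4): `Σ Λ(n)n^{-σ} = −ζ′/ζ(σ) ≪ 1/(σ−1)`] -/
private theorem vonMangoldt_sq_tsum_bounds :
    ∃ K₀ : ℝ, 0 ≤ K₀ ∧ ∀ η : ℝ, 0 < η → η ≤ 1 / 2 →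
      Summable (fun n : ℕ ↦ Λ n ^ 2 / (n : ℝ) ^ (2 + 2 * η)) ∧
      Summable (fun n : ℕ ↦ (n : ℝ) * (Λ n ^ 2 / (n : ℝ) ^ (2 + 2 * η))) ∧
      ∑' n : ℕ, Λ n ^ 2 / (n : ℝ) ^ (2 + 2 * η) ≤ 2 * (2 + K₀) ∧
      ∑' n : ℕ, (n : ℝ) * (Λ n ^ 2 / (n : ℝ) ^ (2 + 2 * η)) ≤ 1 / η * (1 / η + K₀) := by
  obtain ⟨K₀, hK₀, hK, -⟩ := DirichletZFR.exists_norm_logDeriv_le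
  refine ⟨K₀, hK₀, fun η hη hη2 ↦ ?_⟩
  obtain ⟨hs32, hb32⟩ := hK (3 / 2) (by norm_num) (by norm_num)
  obtain ⟨hs1η, hb1η⟩ := hK (1 + η) (by linarith) (by linarith)
  have hnn1 : ∀ n : ℕ, 0 ≤ Λ n ^ 2 / (n : ℝ) ^ (2 + 2 * η) := fun n ↦ by
    have : 0 ≤ Λ n := ArithmeticFunction.vonMangoldt_nonneg; positivity
  have hnn2 : ∀ n : ℕ, 0 ≤ (n : ℝ) * (Λ n ^ 2 / (n : ℝ) ^ (2 + 2 * η)) := fun n ↦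
    mul_nonneg (Nat.cast_nonneg n) (hnn1 n)
  have hS1 : Summable (fun n : ℕ ↦ Λ n ^ 2 / (n : ℝ) ^ (2 + 2 * η)) :=
    Summable.of_nonneg_of_le hnn1 (fun n ↦ vonMangoldt_sq_div_le_one n hη) (hs32.mul_left 2)
  have hS2 : Summable (fun n : ℕ ↦ (n : ℝ) * (Λ n ^ 2 / (n : ℝ) ^ (2 + 2 * η))) :=
    Summable.of_nonneg_of_le hnn2 (fun n ↦ mul_vonMangoldt_sq_div_le n hη) (hs1η.mul_left _)
  refine ⟨hS1, hS2, ?_, ?_⟩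
  · calc ∑' n : ℕ, Λ n ^ 2 / (n : ℝ) ^ (2 + 2 * η) ≤ ∑' n : ℕ, 2 * (Λ n / (n : ℝ) ^ (3 / 2 : ℝ)) :=
          Summable.tsum_le_tsum (fun n ↦ vonMangoldt_sq_div_le_one n hη) hS1 (hs32.mul_left 2)
      _ = 2 * ∑' n : ℕ, Λ n / (n : ℝ) ^ (3 / 2 : ℝ) := tsum_mul_left
      _ ≤ 2 * (2 + K₀) := by
          have : 1 / ((3 / 2 : ℝ) - 1) = 2 := by norm_num
          rw [this] at hb32
          linarith
  · calc ∑' n : ℕ, (n : ℝ) * (Λ n ^ 2 / (n : ℝ) ^ (2 + 2 * η))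
        ≤ ∑' n : ℕ, 1 / η * (Λ n / (n : ℝ) ^ (1 + η)) :=
          Summable.tsum_le_tsum (fun n ↦ mul_vonMangoldt_sq_div_le n hη) hS2 (hs1η.mul_left _)
      _ = 1 / η * ∑' n : ℕ, Λ n / (n : ℝ) ^ (1 + η) := tsum_mul_left
      _ ≤ 1 / η * (1 / η + K₀) := by
          have e : 1 / (1 + η - 1) = 1 / η := by ring_nf
          rw [e] at hb1η
          exact mul_le_mul_of_nonneg_left hb1η (by positivity)

/-! ## 2. `L′/L` on `σ = 1 + η` as a Dirichlet series; the mean square -/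

section MeanSquare

variable {q : ℕ} [NeZero q] (χ : DirichletCharacter ℂ q)

/-- **MV (4.25) on a vertical line**: for `σ > 1` and real `t`,
`L′/L(σ + it, χ) = −Σ_{n ≥ 1} (Λ(n)n^{−σ} χ(n)) · n^{−it}`.
[cite: MontgomeryVaughan2007, (4.25) / §11.1 Lemma 11.2 (proof)] -/
theorem logDeriv_LFunction_eq_neg_tsum {σ : ℝ} (hσ : 1 < σ) (t : ℝ) :
    deriv χ.LFunction (σ + t * I) / χ.LFunction (σ + t * I) =
      -∑' n : ℕ, (((Λ n / (n : ℝ) ^ σ : ℝ) : ℂ) * χ (n : ZMod q)) * (n : ℂ) ^ (-((t : ℂ) * I)) := by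
  have hs : 1 < ((σ : ℂ) + t * I).re := by simp [hσ]
  have h := DirichletZFR.neg_logDeriv_LFunction_eq χ hs
  have hterm : ∀ n : ℕ, LSeries.term (↗χ * ↗Λ) (σ + t * I) n =
      (((Λ n / (n : ℝ) ^ σ : ℝ) : ℂ) * χ (n : ZMod q)) * (n : ℂ) ^ (-((t : ℂ) * I)) := by
    intro n
    rcases eq_or_ne n 0 with rfl | hn
    · simp
    · rw [DirichletZFR.term_twist_eq (↗χ) σ t hn]; ring
  rw [LSeries, tsum_congr hterm] at h
  rw [← h, neg_neg]

/-- **Mean square of `L′/L` on `σ = 1 + η`**, `0 < η ≤ ½`, `T > 0`: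
`∫_{−T}^{T} |L′/L(1 + η + it, χ)|² dt ≤ (5T + 20) · 2(2 + K₀) + 65 · η⁻¹(η⁻¹ + K₀)` — the `ℓ¹`-form of the
Montgomery–Vaughan mean value theorem applied to `c_n = χ(n)Λ(n)n^{−1−η}`.
[cite: MontgomeryVaughan2007, p. 277 with Montgomery–Vaughan 1974, Corollary 3 (as `DirichletMVT.meanSquare_tsum_shift_le`)] -/
theorem integral_normSq_logDeriv_le {K₀ : ℝ}
    (hK : ∀ η : ℝ, 0 < η → η ≤ 1 / 2 →
      Summable (fun n : ℕ ↦ Λ n ^ 2 / (n : ℝ) ^ (2 + 2 * η)) ∧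
      Summable (fun n : ℕ ↦ (n : ℝ) * (Λ n ^ 2 / (n : ℝ) ^ (2 + 2 * η))) ∧
      ∑' n : ℕ, Λ n ^ 2 / (n : ℝ) ^ (2 + 2 * η) ≤ 2 * (2 + K₀) ∧
      ∑' n : ℕ, (n : ℝ) * (Λ n ^ 2 / (n : ℝ) ^ (2 + 2 * η)) ≤ 1 / η * (1 / η + K₀))
    {η : ℝ} (hη : 0 < η) (hη2 : η ≤ 1 / 2) {T : ℝ} (hT : 0 < T) :
    ∫ t in (-T)..T, ‖deriv χ.LFunction ((1 + η : ℝ) + t * I) / χ.LFunction ((1 + η : ℝ) + t * I)‖ ^ 2 ≤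
      (5 * T + 20) * (2 * (2 + K₀)) + 65 * (1 / η * (1 / η + K₀)) := by
  obtain ⟨hS1, hS2, hB1, hB2⟩ := hK η hη hη2
  set σ : ℝ := 1 + η with hσ
  have hσ1 : 1 < σ := by rw [hσ]; linarith
  set c : ℕ → ℂ := fun n ↦ ((Λ n / (n : ℝ) ^ σ : ℝ) : ℂ) * χ (n : ZMod q) with hc
  have hc0 : c 0 = 0 := by simp [hc]
  have hcn : ∀ n, ‖c n‖ ≤ Λ n / (n : ℝ) ^ σ := by
    intro n
    have hΛ : 0 ≤ Λ n / (n : ℝ) ^ σ := by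
      have : 0 ≤ Λ n := ArithmeticFunction.vonMangoldt_nonneg; positivity
    rw [hc, norm_mul, Complex.norm_real, Real.norm_of_nonneg hΛ]
    calc Λ n / (n : ℝ) ^ σ * ‖χ (n : ZMod q)‖ ≤ Λ n / (n : ℝ) ^ σ * 1 := by
          gcongr; exact DirichletCharacter.norm_le_one χ _
      _ = Λ n / (n : ℝ) ^ σ := mul_one _
  have hsq : ∀ n, ‖c n‖ ^ 2 ≤ Λ n ^ 2 / (n : ℝ) ^ (2 + 2 * η) := by
    intro n
    have h := pow_le_pow_left₀ (norm_nonneg _) (hcn n) 2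
    refine h.trans_eq ?_
    rw [div_pow]
    congr 1
    rw [← Real.rpow_two, ← Real.rpow_mul (Nat.cast_nonneg n), hσ]
    ring_nf
  -- summability hypotheses of the MVT
  have hsumσ : Summable (fun n : ℕ ↦ Λ n / (n : ℝ) ^ σ) := by
    have := (DirichletZFR.norm_LSeries_twist_le χ (s := (σ : ℂ)) (by simp [hσ1])).1
    simpa using this
  have hcs : Summable fun n ↦ ‖c n‖ := Summable.of_nonneg_of_le (fun _ ↦ norm_nonneg _) hcn hsumσ
  have hcs2 : Summable fun n : ℕ ↦ (n : ℝ) * ‖c n‖ ^ 2 :=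
    Summable.of_nonneg_of_le (fun n ↦ by positivity)
      (fun n ↦ mul_le_mul_of_nonneg_left (hsq n) (Nat.cast_nonneg n)) hS2
  -- the MVT
  have hMVT := DirichletMVT.meanSquare_tsum_shift_le hcs hcs2 hc0 hT 0
  rw [zero_sub, zero_add] at hMVT
  -- identify the integrand
  have hint : ∀ t : ℝ, ‖deriv χ.LFunction ((σ : ℂ) + t * I) / χ.LFunction ((σ : ℂ) + t * I)‖ ^ 2 =
      ‖∑' n, c n * (n : ℂ) ^ (-((t : ℂ) * I))‖ ^ 2 := by
    intro t
    rw [logDeriv_LFunction_eq_neg_tsum χ hσ1 t, norm_neg]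
  simp_rw [hint]
  refine hMVT.trans ?_
  -- bound the coefficient sum
  have hsplit : ∀ n : ℕ, (5 * T + 20 + 65 * (n : ℝ)) * ‖c n‖ ^ 2 ≤
      (5 * T + 20) * (Λ n ^ 2 / (n : ℝ) ^ (2 + 2 * η)) + 65 * ((n : ℝ) * (Λ n ^ 2 / (n : ℝ) ^ (2 + 2 * η))) := by
    intro n
    have h1 := hsq n
    have hT' : 0 ≤ 5 * T + 20 := by linarith
    nlinarith [mul_le_mul_of_nonneg_left h1 hT', mul_le_mul_of_nonneg_left h1 (Nat.cast_nonneg n),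
      norm_nonneg (c n)]
  have hsumR : Summable fun n : ℕ ↦
      (5 * T + 20) * (Λ n ^ 2 / (n : ℝ) ^ (2 + 2 * η)) + 65 * ((n : ℝ) * (Λ n ^ 2 / (n : ℝ) ^ (2 + 2 * η))) :=
    (hS1.mul_left _).add (hS2.mul_left _)
  have hsumL : Summable fun n : ℕ ↦ (5 * T + 20 + 65 * (n : ℝ)) * ‖c n‖ ^ 2 := by
    refine Summable.of_nonneg_of_le (fun n ↦ ?_) hsplit hsumR
    have : 0 ≤ 5 * T + 20 + 65 * (n : ℝ) := by positivity
    positivity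
  calc ∑' n : ℕ, (5 * T + 20 + 65 * (n : ℝ)) * ‖c n‖ ^ 2
      ≤ ∑' n : ℕ, ((5 * T + 20) * (Λ n ^ 2 / (n : ℝ) ^ (2 + 2 * η)) +
          65 * ((n : ℝ) * (Λ n ^ 2 / (n : ℝ) ^ (2 + 2 * η)))) := Summable.tsum_le_tsum hsplit hsumL hsumR
    _ = (5 * T + 20) * ∑' n : ℕ, Λ n ^ 2 / (n : ℝ) ^ (2 + 2 * η) +
          65 * ∑' n : ℕ, (n : ℝ) * (Λ n ^ 2 / (n : ℝ) ^ (2 + 2 * η)) := by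
        rw [(hS1.mul_left _).tsum_add (hS2.mul_left _), tsum_mul_left, tsum_mul_left]
    _ ≤ (5 * T + 20) * (2 * (2 + K₀)) + 65 * (1 / η * (1 / η + K₀)) := by
        gcongr

end MeanSquare

/-! ## 3. The shift from `σ = 1 + η_T` back to `σ = 1` -/

section Shift

variable {q : ℕ} [NeZero q] (χ : DirichletCharacter ℂ q)

/-- `L′(·, χ)` is entire (`χ ≠ χ₀`). [folklore] -/
private theorem differentiable_deriv_LFunction (hχ : χ ≠ 1) : Differentiable ℂ (deriv χ.LFunction) :=
  ((DirichletCharacter.differentiable_LFunction hχ).contDiff (n := 2)).differentiable_deriv_two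

/-- `L′/L(·, χ)` is differentiable wherever `L(·, χ) ≠ 0`. [folklore] -/
private theorem differentiableAt_logDeriv (hχ : χ ≠ 1) {s : ℂ} (hs : χ.LFunction s ≠ 0) :
    DifferentiableAt ℂ (fun z ↦ deriv χ.LFunction z / χ.LFunction z) s :=
  ((differentiable_deriv_LFunction χ hχ) s).div ((DirichletCharacter.differentiable_LFunction hχ) s) hs

/-- `log 4 > 1`. [folklore] -/
private theorem one_lt_log_four : 1 < Real.log 4 := by
  have h : Real.exp 1 < 4 := by have := Real.exp_one_lt_d9; norm_num at this ⊢; linarith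
  exact (Real.lt_log_iff_exp_lt (by norm_num)).2 h

/-- `log(T + 5) ≥ 1` for `T ≥ 1`. [folklore] -/
private theorem one_le_log_add_five {T : ℝ} (hT : 1 ≤ T) : 1 ≤ Real.log (T + 5) := by
  have h : Real.exp 1 ≤ T + 5 := by have := Real.exp_one_lt_d9; norm_num at this ⊢; linarith
  exact (Real.le_log_iff_exp_le (by linarith)).2 h

/-- **`t ↦ L′/L(σ + it, χ)` is continuous for `σ ≥ 1`** (`L(s, χ) ≠ 0` on `Re s ≥ 1`, Mathlib's
`DirichletCharacter.LFunction_ne_zero_of_one_le_re`). [cite: MontgomeryVaughan2007, §11.1 (Theorem 11.3: no zeros on σ = 1)] -/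
theorem continuous_logDeriv_LFunction_vertical (hχ : χ ≠ 1) {σ : ℝ} (hσ : 1 ≤ σ) :
    Continuous fun t : ℝ ↦ deriv χ.LFunction (σ + t * I) / χ.LFunction (σ + t * I) := by
  have hL := DirichletCharacter.differentiable_LFunction hχ
  have hpath : Continuous fun t : ℝ ↦ (σ : ℂ) + t * I := by fun_prop
  refine ((differentiable_deriv_LFunction χ hχ).continuous.comp hpath).div (hL.continuous.comp hpath)
    fun t ↦ ?_
  exact DirichletCharacter.LFunction_ne_zero_of_one_le_re χ (Or.inl hχ) (by simp [hσ])

/-- The arithmetic of the shift estimate: with `K = (A+1)(2(1+ℓ)/c + 4)`, `LT ≥ 1`, `r = min(c/(2(ℓ+LT)), ¼)`,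
`η = 1/(K LT³)`: `η ≤ r` and `(A·LT/r)·η ≤ 1`. [folklore] -/
private theorem shift_arith {A c lq LT K : ℝ} (hA : 0 ≤ A) (hc : 0 < c) (hlq : 0 ≤ lq) (hLT : 1 ≤ LT)
    (hK : K = (A + 1) * (2 * (1 + lq) / c + 4)) :
    (K * LT ^ 3)⁻¹ ≤ min (c / (2 * (lq + LT))) (1 / 4) ∧
      A * LT / min (c / (2 * (lq + LT))) (1 / 4) * (K * LT ^ 3)⁻¹ ≤ 1 := by
  have hLT0 : 0 < LT := by linarith
  have hℒ0 : 0 < lq + LT := by linarith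
  have hG0 : 0 ≤ 2 * (1 + lq) / c := by positivity
  have hA1 : 1 ≤ A + 1 := by linarith
  have hK4 : (A + 1) * 4 ≤ K := by
    rw [hK]; exact mul_le_mul_of_nonneg_left (by linarith) (by linarith)
  have hKG : (A + 1) * (2 * (1 + lq) / c) ≤ K := by
    rw [hK]; exact mul_le_mul_of_nonneg_left (by linarith) (by linarith)
  have hK0 : 0 < K := by linarith
  have hLT2 : 1 ≤ LT ^ 2 := one_le_pow₀ hLT
  have hLT3 : 1 ≤ LT ^ 3 := one_le_pow₀ hLT
  have hLTle3 : LT ≤ LT ^ 3 := le_self_pow₀ hLT (by norm_num)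
  have hLTle2 : LT ≤ LT ^ 2 := le_self_pow₀ hLT (by norm_num)
  have hℒle : lq + LT ≤ (1 + lq) * LT := by
    have := le_mul_of_one_le_right hlq hLT; linarith
  have hℒle2 : lq + LT ≤ (1 + lq) * LT ^ 2 :=
    hℒle.trans (mul_le_mul_of_nonneg_left hLTle2 (by positivity))
  set r := min (c / (2 * (lq + LT))) (1 / 4) with hr
  have hr0 : 0 < r := lt_min (by positivity) (by norm_num)
  have hKLT : 0 < K * LT ^ 3 := by positivity
  have hKLT2 : 0 < K * LT ^ 2 := by positivity
  have hη_le : (K * LT ^ 3)⁻¹ ≤ r := by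
    rw [hr, le_min_iff, inv_eq_one_div]
    constructor
    · rw [div_le_div_iff₀ hKLT (by positivity)]
      calc 1 * (2 * (lq + LT)) = 2 * (lq + LT) := one_mul _
        _ ≤ 2 * ((1 + lq) * LT) := by linarith
        _ = 1 * (2 * (1 + lq)) * LT := by ring
        _ ≤ (A + 1) * (2 * (1 + lq)) * LT := by gcongr
        _ ≤ (A + 1) * (2 * (1 + lq)) * LT ^ 3 := by gcongr
        _ = c * ((A + 1) * (2 * (1 + lq) / c)) * LT ^ 3 := by field_simp
        _ ≤ c * K * LT ^ 3 := by gcongr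
        _ = c * (K * LT ^ 3) := by ring
    · rw [div_le_div_iff₀ hKLT (by norm_num)]
      have : K ≤ K * LT ^ 3 := le_mul_of_one_le_right hK0.le hLT3
      linarith
  have hMη : A * LT * (K * LT ^ 3)⁻¹ ≤ r := by
    have e : A * LT * (K * LT ^ 3)⁻¹ = A / (K * LT ^ 2) := by
      field_simp
    rw [e, hr, le_min_iff]
    constructor
    · rw [div_le_div_iff₀ hKLT2 (by positivity)]
      calc A * (2 * (lq + LT)) ≤ (A + 1) * (2 * (lq + LT)) := by gcongr; linarith
        _ ≤ (A + 1) * (2 * ((1 + lq) * LT ^ 2)) := by gcongr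
        _ = c * ((A + 1) * (2 * (1 + lq) / c)) * LT ^ 2 := by field_simp
        _ ≤ c * K * LT ^ 2 := by gcongr
        _ = c * (K * LT ^ 2) := by ring
    · rw [div_le_div_iff₀ hKLT2 (by norm_num)]
      calc A * 4 ≤ (A + 1) * 4 := by linarith
        _ ≤ K := hK4
        _ = K * 1 := (mul_one K).symm
        _ ≤ K * LT ^ 2 := by gcongr
        _ = 1 * (K * LT ^ 2) := (one_mul _).symm
  refine ⟨hη_le, ?_⟩
  rw [div_mul_eq_mul_div, div_le_one hr0]
  exact hMη

/-- **The shift estimate** (classical zero-free region + Cauchy's estimate). There is `K ≥ 4`, depending on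
`q` only, such that for every `T ≥ 1`, with `η_T = 1/(K log³(T+5))`, and every `1 ≤ |t| ≤ T`:
`‖L′/L(1 + it, χ) − L′/L(1 + η_T + it, χ)‖ ≤ 1`. Indeed on the disc of radius `2r`,
`r = min(c/(2(log q + log(T+5))), ¼)`, about `1 + it` the tree's `DirichletZFR.exists_norm_logDeriv_le_of_re_ge`
gives `L ≠ 0` and `‖L′/L‖ ≤ 2C(log q + log 4)³ log(T+5)`; Cauchy's estimate bounds `(L′/L)′` by that over `r`
on the disc of radius `r`, and `η_T ≤ r` is chosen so that the product is `≤ 1`.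
[cite: MontgomeryVaughan2007, §11.1 Theorems 11.3–11.4 (zero-free region and `L′/L ≪ log qτ` there)] -/
theorem exists_norm_logDeriv_one_sub_le (hχ : χ ≠ 1) :
    ∃ K : ℝ, 4 ≤ K ∧ ∀ T : ℝ, 1 ≤ T → ∀ t : ℝ, 1 ≤ |t| → |t| ≤ T →
      ‖deriv χ.LFunction (1 + t * I) / χ.LFunction (1 + t * I) -
        deriv χ.LFunction (((1 + (K * Real.log (T + 5) ^ 3)⁻¹ : ℝ) : ℂ) + t * I) /
          χ.LFunction (((1 + (K * Real.log (T + 5) ^ 3)⁻¹ : ℝ) : ℂ) + t * I)‖ ≤ 1 := by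
  obtain ⟨c, hc, C, hC, -, hbd⟩ := DirichletZFR.exists_norm_logDeriv_le_of_re_ge
  have hlogq : 0 ≤ Real.log q := Real.log_natCast_nonneg q
  have hlog4 := one_lt_log_four
  set A : ℝ := 2 * C * (Real.log q + Real.log 4) ^ 3 with hA
  have hA0 : 0 ≤ A := by positivity
  obtain ⟨K, hK⟩ : ∃ K : ℝ, K = (A + 1) * (2 * (1 + Real.log q) / c + 4) := ⟨_, rfl⟩
  have hF2 : 0 ≤ 2 * (1 + Real.log q) / c := by positivity
  have hK4 : 4 ≤ K := by
    rw [hK]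
    calc (4 : ℝ) = 1 * 4 := by norm_num
      _ ≤ (A + 1) * (2 * (1 + Real.log q) / c + 4) := by gcongr <;> linarith
  refine ⟨K, hK4, fun T hT t ht1 htT ↦ ?_⟩
  have hK0 : 0 < K := by linarith
  set f : ℂ → ℂ := fun z ↦ deriv χ.LFunction z / χ.LFunction z with hf
  have hLT1 : 1 ≤ Real.log (T + 5) := one_le_log_add_five hT
  set LT : ℝ := Real.log (T + 5) with hLT
  have hLT0 : 0 < LT := by linarith
  -- the arithmetic, before naming `η`, `r`, `M`
  obtain ⟨hηr, hfinal⟩ := shift_arith hA0 hc hlogq hLT1 hK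
  set ℒT : ℝ := Real.log q + LT with hℒT
  have hℒT0 : 0 < ℒT := by rw [hℒT]; linarith
  set η : ℝ := (K * LT ^ 3)⁻¹ with hη
  have hη0 : 0 < η := by positivity
  set r : ℝ := min (c / (2 * ℒT)) (1 / 4) with hr
  have hr0 : 0 < r := lt_min (by positivity) (by norm_num)
  have hr4 : r ≤ 1 / 4 := min_le_right _ _
  have hrc : r ≤ c / (2 * ℒT) := min_le_left _ _
  set M : ℝ := A * LT with hM
  -- the disc about `z₀ = 1 + it`
  set z₀ : ℂ := 1 + t * I with hz₀
  have hz₀re : z₀.re = 1 := by simp [hz₀]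
  have hz₀im : z₀.im = t := by simp [hz₀]
  have hkey : ∀ w ∈ closedBall z₀ (2 * r), χ.LFunction w ≠ 0 ∧ ‖f w‖ ≤ M := by
    intro w hw
    rw [mem_closedBall, dist_eq_norm] at hw
    have hre : |w.re - 1| ≤ 2 * r := by
      have := abs_re_le_norm (w - z₀); rw [sub_re, hz₀re] at this; linarith
    have him : |w.im - t| ≤ 2 * r := by
      have := abs_im_le_norm (w - z₀); rw [sub_im, hz₀im] at this; linarith
    have him1 : 1 / 2 ≤ |w.im| := by
      have h1 := abs_sub_abs_le_abs_sub t w.im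
      rw [abs_sub_comm] at h1
      linarith
    have him2 : |w.im| ≤ T + 1 / 2 := by
      have h1 := abs_sub_abs_le_abs_sub w.im t
      linarith
    have hlogw : Real.log (|w.im| + 4) ≤ LT := by
      rw [hLT]; exact Real.log_le_log (by positivity) (by linarith)
    have hlogw0 : 0 < Real.log (|w.im| + 4) := Real.log_pos (by linarith [abs_nonneg w.im])
    have hℓw0 : 0 < Real.log q + Real.log (|w.im| + 4) := by linarith
    have hℓwle : Real.log q + Real.log (|w.im| + 4) ≤ ℒT := by rw [hℒT]; linarith
    have hregion : 1 - c / (Real.log q + Real.log (|w.im| + 4)) ≤ w.re := by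
      have h1 : c / ℒT ≤ c / (Real.log q + Real.log (|w.im| + 4)) :=
        div_le_div_of_nonneg_left hc.le hℓw0 hℓwle
      have h2 : 2 * r ≤ c / ℒT := by
        have : c / (2 * ℒT) = c / ℒT / 2 := by ring
        rw [this] at hrc; linarith
      have h3 := (abs_le.1 hre).1
      linarith
    have hdist : ∀ a : ℂ, χ.LFunction a = 0 → a.im = 0 →
        1 - 2 * c / (Real.log q + Real.log 4) < a.re → (1 / 2 : ℝ) ≤ ‖w - a‖ := by
      intro a _ ha _
      have := abs_im_le_norm (w - a)
      rw [sub_im, ha, sub_zero] at this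
      linarith
    obtain ⟨hne, hbound⟩ := hbd q χ hχ w (1 / 2) (by norm_num) (by norm_num) hregion hdist
    refine ⟨hne, hbound.trans ?_⟩
    rw [hM, hA]
    have : C * ((Real.log q + Real.log 4) ^ 3 / (1 / 2)) * Real.log (|w.im| + 4) =
        2 * C * (Real.log q + Real.log 4) ^ 3 * Real.log (|w.im| + 4) := by ring
    rw [this]
    exact mul_le_mul_of_nonneg_left hlogw (by positivity)
  -- differentiability on the big closed disc, derivative bound on the small one
  have hdiff : ∀ w ∈ closedBall z₀ (2 * r), DifferentiableAt ℂ f w := fun w hw ↦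
    differentiableAt_logDeriv χ hχ (hkey w hw).1
  have hderiv : ∀ z ∈ closedBall z₀ r, ‖deriv f z‖ ≤ M / r := by
    intro z hz
    rw [mem_closedBall] at hz
    have hsub : closedBall z r ⊆ closedBall z₀ (2 * r) := by
      intro w hw
      rw [mem_closedBall] at hw ⊢
      calc dist w z₀ ≤ dist w z + dist z z₀ := dist_triangle _ _ _
        _ ≤ r + r := add_le_add hw hz
        _ = 2 * r := by ring
    have hdc : DiffContOnCl ℂ f (ball z r) := by
      refine DifferentiableOn.diffContOnCl ?_
      rw [closure_ball z hr0.ne']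
      exact fun w hw ↦ (hdiff w (hsub hw)).differentiableWithinAt
    exact Complex.norm_deriv_le_of_forall_mem_sphere_norm_le hr0 hdc
      fun w hw ↦ (hkey w (hsub (sphere_subset_closedBall hw))).2
  -- mean value inequality on `closedBall z₀ r`
  set y : ℂ := ((1 + η : ℝ) : ℂ) + t * I with hy
  have hyz : y - z₀ = (η : ℂ) := by rw [hy, hz₀]; push_cast; ring
  have hy_mem : y ∈ closedBall z₀ r := by
    rw [mem_closedBall, dist_eq_norm, hyz, Complex.norm_real, Real.norm_of_nonneg hη0.le]
    exact hηr
  have hz₀_mem : z₀ ∈ closedBall z₀ r := mem_closedBall_self hr0.le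
  have hmv := (convex_closedBall z₀ r).norm_image_sub_le_of_norm_deriv_le
    (fun x hx ↦ hdiff x (closedBall_subset_closedBall (by linarith) hx)) hderiv hz₀_mem hy_mem
  rw [hyz, Complex.norm_real, Real.norm_of_nonneg hη0.le] at hmv
  rw [← norm_neg, neg_sub]
  exact hmv.trans hfinal

end Shift

/-! ## 4. The `L¹` bound on `σ = 1` -/

section Main

variable {q : ℕ} [NeZero q] (χ : DirichletCharacter ℂ q)

/-- `log(T+5)⁶ ≤ 6⁷ T` for `T ≥ 1` (`log x ≤ 6 x^{1/6}`). [folklore] -/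
private theorem log_pow_six_le {T : ℝ} (hT : 1 ≤ T) : Real.log (T + 5) ^ 6 ≤ 6 ^ 7 * T := by
  have h5 : 0 ≤ T + 5 := by linarith
  have hlog0 : 0 ≤ Real.log (T + 5) := Real.log_nonneg (by linarith)
  have h1 : Real.log (T + 5) ≤ 6 * (T + 5) ^ (1 / 6 : ℝ) := by
    have := Real.log_le_rpow_div h5 (by norm_num : (0:ℝ) < 1 / 6)
    linarith
  have h2 : Real.log (T + 5) ^ 6 ≤ (6 * (T + 5) ^ (1 / 6 : ℝ)) ^ 6 :=
    pow_le_pow_left₀ hlog0 h1 6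
  have h3 : ((T + 5) ^ (1 / 6 : ℝ)) ^ 6 = T + 5 := by
    rw [← Real.rpow_natCast, ← Real.rpow_mul h5]; norm_num
  calc Real.log (T + 5) ^ 6 ≤ (6 * (T + 5) ^ (1 / 6 : ℝ)) ^ 6 := h2
    _ = 6 ^ 6 * (T + 5) := by rw [mul_pow, h3]
    _ ≤ 6 ^ 7 * T := by nlinarith

/-- **The mean value of `L′/L` on `σ = 1`.** For a non-principal Dirichlet character `χ` mod `q` there is a
constant `C = C(χ)` with `∫_{−T}^{T} ‖L′/L(1 + it, χ)‖ dt ≤ C·T` for every `T ≥ 1`. This is the averaged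
substitute for Lagarias' "analogue of Lemma 4.1 (2)" (`L′/L(1+iT, χ) = o(log T)`), sufficient for the
zero-spacing count of Theorem 5.2 (1) at `|h| = ½` (sibling `LagariasSpacingAveragedPhaseProofs.lean`).
Proof: §2 mean square on `σ_T = 1 + η_T` + `|x| ≤ ½ + ½x²`, §3 shift for `1 ≤ |t| ≤ T`, continuity on
`|t| ≤ 1`. [cite: Lagarias2005, proof of Theorem 5.2 (arXiv p. 10; held text p0010:L143–175); MontgomeryVaughan2007, §11.1 Theorems 11.3–11.4] -/
theorem exists_integral_norm_logDeriv_one_le (hχ : χ ≠ 1) :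
    ∃ C : ℝ, ∀ T : ℝ, 1 ≤ T →
      (∫ t in (-T)..T, ‖deriv χ.LFunction (1 + t * I) / χ.LFunction (1 + t * I)‖) ≤ C * T := by
  obtain ⟨K₀, hK₀, hK⟩ := vonMangoldt_sq_tsum_bounds
  obtain ⟨K, hK4, hshift⟩ := exists_norm_logDeriv_one_sub_le χ hχ
  have hK0 : 0 < K := by linarith
  set f : ℂ → ℂ := fun s ↦ deriv χ.LFunction s / χ.LFunction s with hf
  have hcont1 : Continuous fun t : ℝ ↦ f (1 + t * I) := by
    have := continuous_logDeriv_LFunction_vertical χ hχ (σ := 1) le_rfl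
    simpa [hf] using this
  obtain ⟨M₀, hM₀⟩ : ∃ M₀ : ℝ, ∀ t ∈ Icc (-1 : ℝ) 1, ‖f (1 + t * I)‖ ≤ M₀ :=
    isCompact_Icc.exists_bound_of_continuousOn hcont1.continuousOn
  have hM₀0 : 0 ≤ M₀ := le_trans (norm_nonneg _) (hM₀ 0 (by norm_num))
  refine ⟨2 * M₀ + 3 + 25 * (2 + K₀) + 33 * (K ^ 2 * 6 ^ 7 * (1 + K₀)), fun T hT ↦ ?_⟩
  have hT0 : 0 < T := by linarith
  have hLT1 : 1 ≤ Real.log (T + 5) := one_le_log_add_five hT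
  set LT : ℝ := Real.log (T + 5) with hLT
  set η : ℝ := (K * LT ^ 3)⁻¹ with hη
  have hLT3 : 1 ≤ LT ^ 3 := one_le_pow₀ hLT1
  have hKLT1 : 1 ≤ K * LT ^ 3 := by nlinarith
  have hKLT : 0 < K * LT ^ 3 := by positivity
  have hη0 : 0 < η := by positivity
  have hη2 : η ≤ 1 / 2 := by
    rw [hη]
    have hKLT4 : 4 ≤ K * LT ^ 3 := by
      have : K ≤ K * LT ^ 3 := le_mul_of_one_le_right hK0.le hLT3
      linarith
    calc (K * LT ^ 3)⁻¹ ≤ (4 : ℝ)⁻¹ := inv_anti₀ (by norm_num) hKLT4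
      _ ≤ 1 / 2 := by norm_num
  have hσ1 : (1 : ℝ) ≤ 1 + η := le_add_of_nonneg_right hη0.le
  set σ : ℝ := 1 + η with hσ
  have hcontσ : Continuous fun t : ℝ ↦ f (σ + t * I) := by
    have := continuous_logDeriv_LFunction_vertical χ hχ (σ := σ) hσ1
    simpa [hf] using this
  -- pointwise majorant on `[-T, T]`
  have hpt : ∀ t ∈ Icc (-T) T, ‖f (1 + t * I)‖ ≤ M₀ + 3 / 2 + 1 / 2 * ‖f (σ + t * I)‖ ^ 2 := by
    intro t ht
    have hsq : 0 ≤ ‖f (σ + t * I)‖ ^ 2 := by positivity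
    rcases le_or_gt |t| 1 with h1 | h1
    · have := hM₀ t (abs_le.1 h1)
      linarith
    · have hs := hshift T hT t h1.le (abs_le.2 ht)
      have e : (((1 + (K * Real.log (T + 5) ^ 3)⁻¹ : ℝ) : ℂ) + t * I) = (σ : ℂ) + t * I := by
        rw [hσ, hη, hLT]
      rw [e] at hs
      have hx : ‖f (1 + t * I)‖ ≤ ‖f (σ + t * I)‖ + 1 := by
        have := norm_sub_norm_le (f (1 + t * I)) (f (σ + t * I))
        simp only [hf] at this hs ⊢
        linarith
      nlinarith [sq_nonneg (‖f (σ + t * I)‖ - 1)]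
  -- integrate the majorant
  have hgi2 : IntervalIntegrable (fun t : ℝ ↦ 1 / 2 * ‖f (σ + t * I)‖ ^ 2) volume (-T) T :=
    (continuous_const.mul (hcontσ.norm.pow 2)).intervalIntegrable _ _
  have hgi : IntervalIntegrable (fun t : ℝ ↦ M₀ + 3 / 2 + 1 / 2 * ‖f (σ + t * I)‖ ^ 2) volume (-T) T :=
    (continuous_const.add (continuous_const.mul (hcontσ.norm.pow 2))).intervalIntegrable _ _
  have hni : IntervalIntegrable (fun t : ℝ ↦ ‖f (1 + t * I)‖) volume (-T) T :=
    hcont1.norm.intervalIntegrable _ _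
  have hmono : (∫ t in (-T)..T, ‖f (1 + t * I)‖) ≤
      ∫ t in (-T)..T, (M₀ + 3 / 2 + 1 / 2 * ‖f (σ + t * I)‖ ^ 2) :=
    intervalIntegral.integral_mono_on (by linarith) hni hgi hpt
  have hsplit : (∫ t in (-T)..T, (M₀ + 3 / 2 + 1 / 2 * ‖f (σ + t * I)‖ ^ 2)) =
      (M₀ + 3 / 2) * (2 * T) + 1 / 2 * ∫ t in (-T)..T, ‖f (σ + t * I)‖ ^ 2 := by
    have hadd := intervalIntegral.integral_add
      (intervalIntegrable_const (μ := volume) (a := -T) (b := T) (c := M₀ + 3 / 2)) hgi2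
    simp only [intervalIntegral.integral_const, intervalIntegral.integral_const_mul, smul_eq_mul] at hadd
    rw [hadd]
    ring
  -- the mean square
  have hms : (∫ t in (-T)..T, ‖f (σ + t * I)‖ ^ 2) ≤ (5 * T + 20) * (2 * (2 + K₀)) + 65 * (1 / η * (1 / η + K₀)) := by
    have := integral_normSq_logDeriv_le χ hK hη0 hη2 hT0
    simpa [hf, hσ] using this
  -- `η⁻¹(η⁻¹ + K₀) ≤ K² 6⁷ (1 + K₀) T`
  have hpoly : 1 / η * (1 / η + K₀) ≤ K ^ 2 * 6 ^ 7 * (1 + K₀) * T := by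
    have e1 : 1 / η = K * LT ^ 3 := by rw [hη, one_div, inv_inv]
    rw [e1]
    set u : ℝ := K * LT ^ 3 with hu
    have hu1 : 1 ≤ u := hKLT1
    have hu2 : u ≤ u ^ 2 := le_self_pow₀ hu1 (by norm_num)
    have h1 : u * K₀ ≤ u ^ 2 * K₀ := mul_le_mul_of_nonneg_right hu2 hK₀
    have hL6 : LT ^ 6 ≤ 6 ^ 7 * T := log_pow_six_le hT
    have h3 : u ^ 2 = K ^ 2 * LT ^ 6 := by rw [hu]; ring
    have h4 : K ^ 2 * LT ^ 6 ≤ K ^ 2 * (6 ^ 7 * T) := mul_le_mul_of_nonneg_left hL6 (by positivity)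
    have h5 : 0 ≤ u ^ 2 := by positivity
    calc u * (u + K₀) = u ^ 2 + u * K₀ := by ring
      _ ≤ u ^ 2 + u ^ 2 * K₀ := by linarith
      _ = u ^ 2 * (1 + K₀) := by ring
      _ ≤ K ^ 2 * (6 ^ 7 * T) * (1 + K₀) := by
          rw [h3]; exact mul_le_mul_of_nonneg_right h4 (by linarith)
      _ = K ^ 2 * 6 ^ 7 * (1 + K₀) * T := by ring
  -- assemble
  calc (∫ t in (-T)..T, ‖f (1 + t * I)‖)
      ≤ (M₀ + 3 / 2) * (2 * T) + 1 / 2 * ∫ t in (-T)..T, ‖f (σ + t * I)‖ ^ 2 := hmono.trans_eq hsplit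
    _ ≤ (M₀ + 3 / 2) * (2 * T) + 1 / 2 * ((5 * T + 20) * (2 * (2 + K₀)) + 65 * (1 / η * (1 / η + K₀))) := by
        gcongr
    _ ≤ (M₀ + 3 / 2) * (2 * T) + 1 / 2 * ((5 * T + 20 * T) * (2 * (2 + K₀)) +
          65 * (K ^ 2 * 6 ^ 7 * (1 + K₀) * T)) := by
        gcongr
        · linarith
    _ ≤ (2 * M₀ + 3 + 25 * (2 + K₀) + 33 * (K ^ 2 * 6 ^ 7 * (1 + K₀))) * T := by
        have : 0 ≤ K ^ 2 * 6 ^ 7 * (1 + K₀) * T := by positivity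
        nlinarith

end Main

end DirichletLogDerivMeanValue

end Literature.NumberTheory.LFunctions
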